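import Summits.SmoothPoincare4.SmoothPoincare4.Theorems.SullivanDualTargetHelperLineEnergyFlat
import Summits.SmoothPoincare4.SmoothPoincare4.Theorems.SullivanDualWitnessChargeHelperEndHolomorphic
import Summits.SmoothPoincare4.SmoothPoincare4.Theorems.SullivanDualWitnessChargeHelperDecayAtInfinity

/-!
# Helper `helper_lineEnergy_line_lt_top` of the line `crofton-pencil-laminar-charge`, crux `Target`
(item stmt-SmoothPoincare4-7823, route route-SmoothPoincare4-SullivanDual)

Every LINE has finite energy: if `J` is standard on the punctured `ε'`-chart-ball at `p` (closed
`ε'`-ball inside the chart target) and `u : ℂ → Σ ∖ p` is a `J`-line of chart `σ` with data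
`(a, b)` (`IsLine σ J u a b`: a proper, injective, immersed, non-constant entire `J`-curve with
`(Yc σ p (u ξ)).1 − ξ → 0` and `(Yc σ p (u ξ)).2 − a ξ → b` at infinity), then for every smooth
`ι : Σ → ℝᴺ` the energy `lineEnergy ι u = ∫⁻ ‖d(ι ∘ u)‖²` is finite. Hence `BoundedLines` is a
genuine uniform-bound condition (each single energy being finite).

Proof.
1. PROPERNESS (`eventually_inBall_of_proper`, the argument of `helper_memberEventuallyInBall`):
   the complement in `Σ ∖ p` of the punctured `ε'`-chart-ball is compact, so its preimage under
   the proper `u` is bounded: `u ξ` lies in the ball for `‖ξ‖ > r₀`.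
2. HOLOMORPHY AND DECAY (`fderiv_bound_of_asymptotic`): there `Y ∘ u` (`Y = Ycoord p`) is complex
   differentiable (`differentiableAt_Ycoord_comp`, `J` being standard), so the error terms
   `g₁ ξ = (Yc σ (u ξ)).1 − ξ` and `g₂ ξ = (Yc σ (u ξ)).2 − a ξ − b` are holomorphic near infinity
   and tend to `0`; `helper_decayAtInfinity` gives `‖gᵢ ξ‖ ≤ C/‖ξ‖`, `‖gᵢ' ξ‖ ≤ C/‖ξ‖²`, whence
   `‖d(Y ∘ u)(ξ)‖ ≤ D` and `‖ξ‖ ≤ 2 ‖realify (Y (u ξ))‖` for `‖ξ‖ ≥ r₁`.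
3. CHAIN RULE (`norm_fderiv_comp_le_of_eventually`, as in `norm_fderiv_comp_le_of_affine`): near
   such `ξ`, `ι ∘ u = g ∘ (e p + inv ∘ realify ∘ Y ∘ u)` with `g = ι ∘ e.symm` (derivative
   bounded by `M` on the compact closed ball) and `‖D inv(y)‖ ≤ ‖y‖⁻²`, so
   `‖d(ι ∘ u)(ξ)‖ ≤ M ‖realifyL‖ D ‖realify (Y (u ξ))‖⁻² ≤ C' ‖ξ‖⁻²`.
4. COMPACT PART: `ι ∘ u` is `C^∞`, so `‖d(ι ∘ u)‖ ≤ M'` on the closed `r₁`-ball.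
5. INTEGRAL: `‖d(ι ∘ u)(ξ)‖² ≤ K (1 + ‖ξ‖)⁻⁴` everywhere (`sq_le_decay` far out), and
   `∫ (1 + ‖ξ‖)⁻⁴ < ∞` on `ℂ` (`finite_integral_one_add_norm`, `finrank ℝ ℂ = 2 < 4`).
-/

noncomputable section

-- the prescribed namespace `Summit.<P>.<Sub>.…` duplicates `SmoothPoincare4` (P = Sub)
set_option linter.dupNamespace false

open scoped Manifold ContDiff Topology ENNReal NNReal
open Set Filter MeasureTheory Literature.Geometry.Kaehler Literature.Geometry.Symplectic
  Literature.Topology.FourManifolds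
open Summit.SmoothPoincare4.SmoothPoincare4.Theorems.WitnessCharge.PencilIncompleteness

namespace Summit.SmoothPoincare4.SmoothPoincare4.Theorems.Target.CroftonPencil

variable {S : HomotopySphere 4}

/-! ### Properness: a proper curve eventually enters every punctured chart-ball -/

/-- A PROPER curve `u : ℂ → Σ ∖ p` (preimages of compact sets compact) eventually enters every
punctured chart-ball at `p`: for `η > 0` there is `r` with `u ξ` in the punctured `η`-chart-ball
whenever `‖ξ‖ > r` (the complement of the ball in `Σ ∖ p` is compact, `Σ` being compact, so its
preimage is bounded). The argument of `helper_memberEventuallyInBall`, for any proper curve. -/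
theorem eventually_inBall_of_proper {p : S.carrier} {u : ℂ → punctured p}
    (hproper : ∀ K : Set (punctured p), IsCompact K → IsCompact (u ⁻¹' K)) {η : ℝ} (hη : 0 < η) :
    ∃ r : ℝ, ∀ ξ : ℂ, r < ‖ξ‖ → InPuncturedChartBall p η (u ξ) := by
  -- adapted from `helper_memberEventuallyInBall` (pencil members), same proof for proper curves
  have hK : IsCompact (u ⁻¹' {x : punctured p | InPuncturedChartBall p η x}ᶜ) :=
    hproper _ (gromov_recognitionR4_relEnd.isCompact_compl_setOf_inPuncturedChartBall p hη)
  obtain ⟨r, hr⟩ := isBounded_iff_forall_norm_le.1 hK.isBounded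
  refine ⟨r, fun ξ hξ => ?_⟩
  by_contra hnot
  exact absurd (hr ξ hnot) (not_le.2 hξ)

/-! ### Complex analysis: a holomorphic germ at infinity asymptotic to an affine line -/

/-- DECAY AT INFINITY. Let `Y : ℂ → ℂ × ℂ` be complex differentiable on `{r < ‖ξ‖}` and asymptotic
to the affine line `ξ ↦ (ξ, a ξ + b)`: `(Y ξ).1 − ξ → 0` and `(Y ξ).2 − a ξ → b` at infinity. Then
beyond some radius `r₁ ≥ max r 1` the real derivative of `Y` is bounded, `‖dY(ξ)‖ ≤ D`, and the
first coordinate dominates the parameter, `‖ξ‖ ≤ 2 ‖(Y ξ).1‖`. (The error terms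
`g₁ = Y₁ − id`, `g₂ = Y₂ − (a · + b)` are holomorphic near infinity and vanish there, so
`helper_decayAtInfinity` gives `‖gᵢ ξ‖ ≤ C/‖ξ‖` and `‖gᵢ' ξ‖ ≤ C/‖ξ‖²`.) -/
theorem fderiv_bound_of_asymptotic {Y : ℂ → ℂ × ℂ} {r : ℝ} {a b : ℂ}
    (hY : DifferentiableOn ℂ Y {ξ : ℂ | r < ‖ξ‖})
    (h1 : Tendsto (fun ξ : ℂ => (Y ξ).1 - ξ) (cocompact ℂ) (𝓝 0))
    (h2 : Tendsto (fun ξ : ℂ => (Y ξ).2 - a * ξ) (cocompact ℂ) (𝓝 b)) :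
    ∃ D r₁ : ℝ, 0 ≤ D ∧ 1 ≤ r₁ ∧ r ≤ r₁ ∧ ∀ ξ : ℂ, r₁ ≤ ‖ξ‖ →
      ‖fderiv ℝ Y ξ‖ ≤ D ∧ ‖ξ‖ ≤ 2 * ‖(Y ξ).1‖ := by
  -- the two holomorphic error terms, vanishing at infinity
  set g₁ : ℂ → ℂ := fun ξ => (Y ξ).1 - ξ with hg₁
  set g₂ : ℂ → ℂ := fun ξ => (Y ξ).2 - a * ξ - b with hg₂
  have hr' : r < max r 0 + 1 := by linarith [le_max_left r 0]
  have h1r' : 1 ≤ max r 0 + 1 := by linarith [le_max_right r 0]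
  have hY' : DifferentiableOn ℂ Y {ξ : ℂ | max r 0 + 1 < ‖ξ‖} :=
    hY.mono fun ξ (hξ : max r 0 + 1 < ‖ξ‖) => hr'.trans hξ
  have hd₁ : DifferentiableOn ℂ g₁ {ξ : ℂ | max r 0 + 1 < ‖ξ‖} := hY'.fst.sub differentiableOn_id
  have hd₂ : DifferentiableOn ℂ g₂ {ξ : ℂ | max r 0 + 1 < ‖ξ‖} :=
    (hY'.snd.sub (differentiableOn_id.const_mul a)).sub_const b
  have hl₂ : Tendsto g₂ (cocompact ℂ) (𝓝 0) := tendsto_sub_nhds_zero_iff.2 h2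
  obtain ⟨C₁, s₁, -, hrs₁, hdec₁⟩ := helper_decayAtInfinity g₁ (max r 0 + 1) hd₁ h1
  obtain ⟨C₂, s₂, -, hrs₂, hdec₂⟩ := helper_decayAtInfinity g₂ (max r 0 + 1) hd₂ hl₂
  refine ⟨max (|C₁| + 1) (|C₂| + ‖a‖), max (max s₁ s₂) (2 * |C₁|), by positivity,
    h1r'.trans (hrs₁.trans ((le_max_left _ _).trans (le_max_left _ _))),
    hr'.le.trans (hrs₁.trans ((le_max_left _ _).trans (le_max_left _ _))), fun ξ hξ => ?_⟩
  have hs₁ξ : s₁ ≤ ‖ξ‖ := (le_max_left _ _).trans ((le_max_left _ _).trans hξ)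
  have hs₂ξ : s₂ ≤ ‖ξ‖ := (le_max_right _ _).trans ((le_max_left _ _).trans hξ)
  have hCξ : 2 * |C₁| ≤ ‖ξ‖ := (le_max_right _ _).trans hξ
  have h1ξ : 1 ≤ ‖ξ‖ := h1r'.trans (hrs₁.trans hs₁ξ)
  have hrξ : r < ‖ξ‖ := hr'.trans_le (hrs₁.trans hs₁ξ)
  have hξ0 : 0 < ‖ξ‖ := one_pos.trans_le h1ξ
  obtain ⟨hg₁ξ, hdg₁ξ⟩ := hdec₁ ξ hs₁ξ
  obtain ⟨-, hdg₂ξ⟩ := hdec₂ ξ hs₂ξ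
  -- differentiability at `ξ` and the derivative of `Y = (g₁ + id, g₂ + (a · + b))`
  have hYξ : DifferentiableAt ℂ Y ξ :=
    hY.differentiableAt ((isOpen_lt continuous_const continuous_norm).mem_nhds hrξ)
  have hG₁ : HasDerivAt g₁ (deriv g₁ ξ) ξ := (hYξ.fst.sub differentiableAt_id).hasDerivAt
  have hG₂ : HasDerivAt g₂ (deriv g₂ ξ) ξ :=
    ((hYξ.snd.sub (differentiableAt_id.const_mul a)).sub_const b).hasDerivAt
  have hY1 : HasDerivAt (fun ζ : ℂ => (Y ζ).1) (deriv g₁ ξ + 1) ξ := by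
    have h : HasDerivAt (fun ζ : ℂ => g₁ ζ + ζ) (deriv g₁ ξ + 1) ξ := hG₁.add (hasDerivAt_id ξ)
    exact h.congr_of_eventuallyEq (Eventually.of_forall fun ζ => by simp [hg₁])
  have hY2 : HasDerivAt (fun ζ : ℂ => (Y ζ).2) (deriv g₂ ξ + a) ξ := by
    have h : HasDerivAt (fun ζ : ℂ => g₂ ζ + (a * ζ + b)) (deriv g₂ ξ + a) ξ :=
      hG₂.add ((hasDerivAt_const_mul a).add_const b)
    exact h.congr_of_eventuallyEq (Eventually.of_forall fun ζ => by simp [hg₂])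
  have hYd : HasFDerivAt Y
      ((ContinuousLinearMap.smulRight (1 : ℂ →L[ℂ] ℂ)
        (deriv g₁ ξ + 1, deriv g₂ ξ + a)).restrictScalars ℝ) ξ :=
    (hY1.prodMk hY2).hasFDerivAt.restrictScalars ℝ
  rw [hYd.fderiv]
  -- elementary bounds
  have hb₁ : ‖deriv g₁ ξ + 1‖ ≤ |C₁| + 1 := by
    refine (norm_add_le _ _).trans ?_
    rw [norm_one]
    gcongr
    calc ‖deriv g₁ ξ‖ ≤ C₁ / ‖ξ‖ ^ 2 := hdg₁ξ
      _ ≤ |C₁| / ‖ξ‖ ^ 2 := by gcongr; exact le_abs_self C₁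
      _ ≤ |C₁| := div_le_self (abs_nonneg C₁) (one_le_pow₀ h1ξ)
  have hb₂ : ‖deriv g₂ ξ + a‖ ≤ |C₂| + ‖a‖ := by
    refine (norm_add_le _ _).trans ?_
    gcongr
    calc ‖deriv g₂ ξ‖ ≤ C₂ / ‖ξ‖ ^ 2 := hdg₂ξ
      _ ≤ |C₂| / ‖ξ‖ ^ 2 := by gcongr; exact le_abs_self C₂
      _ ≤ |C₂| := div_le_self (abs_nonneg C₂) (one_le_pow₀ h1ξ)
  constructor
  · refine ContinuousLinearMap.opNorm_le_bound _ (by positivity) fun v => ?_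
    simp only [ContinuousLinearMap.coe_restrictScalars', ContinuousLinearMap.smulRight_apply,
      one_apply_eq_self, norm_smul, Prod.norm_mk]
    rw [mul_comm]
    exact mul_le_mul_of_nonneg_right (max_le_max hb₁ hb₂) (norm_nonneg v)
  · have hg₁' : ‖g₁ ξ‖ ≤ ‖ξ‖ / 2 := by
      refine hg₁ξ.trans ?_
      rw [div_le_div_iff₀ hξ0 two_pos]
      nlinarith [le_abs_self C₁, mul_nonneg hξ0.le (sub_nonneg.2 h1ξ)]
    have hsub : (Y ξ).1 - g₁ ξ = ξ := by
      simp only [hg₁]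
      ring
    have htri : ‖ξ‖ ≤ ‖(Y ξ).1‖ + ‖g₁ ξ‖ := by
      calc ‖ξ‖ = ‖(Y ξ).1 - g₁ ξ‖ := by rw [hsub]
        _ ≤ ‖(Y ξ).1‖ + ‖g₁ ξ‖ := norm_sub_le _ _
    linarith

/-! ### The chain rule through the flat chart -/

/-- CHAIN RULE THROUGH THE FLAT CHART. For `ι : Σ → ℝᴺ` smooth and the closed `ε'`-ball inside the
chart target there is `M ≥ 0` such that for any curve `u : ℂ → Σ ∖ p` and any `ξ` near which `u`
stays in the punctured `ε'`-chart-ball and at which `Y ∘ u` (`Y = Ycoord p`) is real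
differentiable, `‖d(ι ∘ u)(ξ)‖ ≤ M ‖d(Y ∘ u)(ξ)‖ ‖realify (Y (u ξ))‖⁻²`: near `ξ`,
`ι ∘ u = g ∘ (e p + inv ∘ realify ∘ Y ∘ u)` with `g = ι ∘ e.symm`, whose derivative is bounded on
the compact closed `ε'`-ball, and `‖D inv(y)‖ ≤ ‖y‖⁻²` (cf. `norm_fderiv_comp_le_of_affine`). -/
theorem norm_fderiv_comp_le_of_eventually {p : S.carrier} {ε' : ℝ} {N : ℕ}
    {ι : S.carrier → EuclideanSpace ℝ (Fin N)} (hε' : 0 < ε')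
    (hball : Metric.closedBall (extChartAt (𝓡 4) p p) ε' ⊆ (extChartAt (𝓡 4) p).target)
    (hι : ContMDiff (𝓡 4) 𝓘(ℝ, EuclideanSpace ℝ (Fin N)) ∞ ι) (u : ℂ → punctured p) :
    ∃ M : ℝ, 0 ≤ M ∧ ∀ ξ : ℂ, (∀ᶠ ζ in 𝓝 ξ, InPuncturedChartBall p ε' (u ζ)) →
      DifferentiableAt ℝ (fun ζ : ℂ => Ycoord p (u ζ)) ξ →
      ‖fderiv ℝ (fun ζ : ℂ => ι (u ζ).1) ξ‖ ≤
        M * ‖fderiv ℝ (fun ζ : ℂ => Ycoord p (u ζ)) ξ‖ * (‖realify (Ycoord p (u ξ))‖ ^ 2)⁻¹ := by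
  -- `g = ι ∘ e.symm` is smooth on the open chart target, with derivative bounded by `M` on the
  -- compact closed `ε'`-ball (as in `norm_fderiv_comp_le_of_affine`)
  have hg : ContDiffOn ℝ ∞ (ι ∘ (extChartAt (𝓡 4) p).symm) (extChartAt (𝓡 4) p).target :=
    contMDiffOn_iff_contDiffOn.1
      (hι.comp_contMDiffOn (contMDiffOn_extChartAt_symm (I := 𝓡 4) (n := ∞) p))
  have hcont : ContinuousOn (fderiv ℝ (ι ∘ (extChartAt (𝓡 4) p).symm))
      (extChartAt (𝓡 4) p).target :=
    hg.continuousOn_fderiv_of_isOpen (isOpen_extChartAt_target (I := 𝓡 4) p) (by simp)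
  obtain ⟨M, hM⟩ := (isCompact_closedBall (extChartAt (𝓡 4) p p) ε').exists_bound_of_continuousOn
    (hcont.mono hball)
  have hM0 : 0 ≤ M := (norm_nonneg _).trans (hM _ (Metric.mem_closedBall_self hε'.le))
  refine ⟨M * ‖realifyL‖, by positivity, fun ξ hev hYd => ?_⟩
  have hξ : InPuncturedChartBall p ε' (u ξ) := hev.self_of_nhds
  have hstd : ε'⁻¹ < ‖realify (Ycoord p (u ξ))‖ := Ycoord_mem_stdEnd hε' hξ
  have hy0 : realify (Ycoord p (u ξ)) ≠ 0 := realify_ne_zero_of_lt hε' hstd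
  have hballmem : extChartAt (𝓡 4) p p + inversion (realify (Ycoord p (u ξ))) ∈
      Metric.closedBall (extChartAt (𝓡 4) p p) ε' := by
    rw [Metric.mem_closedBall, dist_eq_norm, add_sub_cancel_left]
    exact (norm_inversion_realify_lt_of_lt hε' hstd).le
  have htgt : extChartAt (𝓡 4) p p + inversion (realify (Ycoord p (u ξ))) ∈
      (extChartAt (𝓡 4) p).target :=
    hball hballmem
  -- near `ξ` the curve factors through the flat chart: `ι ∘ u = g ∘ (e p + inv ∘ realify ∘ Y ∘ u)`
  have hfun : (fun ζ : ℂ => ι (u ζ).1) =ᶠ[𝓝 ξ] fun ζ : ℂ =>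
      (ι ∘ (extChartAt (𝓡 4) p).symm)
        (extChartAt (𝓡 4) p p + inversion (realify (Ycoord p (u ζ)))) := by
    filter_upwards [hev] with ζ hζ
    rw [Function.comp_apply, realify_Ycoord, inversion_inversion, add_sub_cancel,
      (extChartAt (𝓡 4) p).left_inv (by rw [extChartAt_source]; exact hζ.1)]
  have hF : HasFDerivAt
      (fun ζ : ℂ => extChartAt (𝓡 4) p p + inversion (realify (Ycoord p (u ζ))))
      ((fderiv ℝ inversion (realify (Ycoord p (u ξ)))).comp
        (realifyL.comp (fderiv ℝ (fun ζ : ℂ => Ycoord p (u ζ)) ξ))) ξ := by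
    have h1 : HasFDerivAt (fun ζ : ℂ => Ycoord p (u ζ))
        (fderiv ℝ (fun ζ : ℂ => Ycoord p (u ζ)) ξ) ξ := hYd.hasFDerivAt
    have h2 : HasFDerivAt (fun q : ℂ × ℂ => realify q) realifyL (Ycoord p (u ξ)) :=
      realifyL.hasFDerivAt
    have h3 : HasFDerivAt inversion (fderiv ℝ inversion (realify (Ycoord p (u ξ))))
        (realify (Ycoord p (u ξ))) :=
      (differentiableAt_inversion hy0).hasFDerivAt
    exact (h3.comp ξ (h2.comp ξ h1)).const_add (extChartAt (𝓡 4) p p)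
  have hgd : DifferentiableAt ℝ (ι ∘ (extChartAt (𝓡 4) p).symm)
      (extChartAt (𝓡 4) p p + inversion (realify (Ycoord p (u ξ)))) :=
    (hg.differentiableOn (by simp)).differentiableAt
      ((isOpen_extChartAt_target (I := 𝓡 4) p).mem_nhds htgt)
  have hD : fderiv ℝ (fun ζ : ℂ => ι (u ζ).1) ξ =
      (fderiv ℝ (ι ∘ (extChartAt (𝓡 4) p).symm)
        (extChartAt (𝓡 4) p p + inversion (realify (Ycoord p (u ξ))))).comp
        ((fderiv ℝ inversion (realify (Ycoord p (u ξ)))).comp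
          (realifyL.comp (fderiv ℝ (fun ζ : ℂ => Ycoord p (u ζ)) ξ))) := by
    rw [hfun.fderiv_eq]
    exact (hgd.hasFDerivAt.comp ξ hF).fderiv
  rw [hD]
  calc ‖(fderiv ℝ (ι ∘ (extChartAt (𝓡 4) p).symm)
        (extChartAt (𝓡 4) p p + inversion (realify (Ycoord p (u ξ))))).comp
        ((fderiv ℝ inversion (realify (Ycoord p (u ξ)))).comp
          (realifyL.comp (fderiv ℝ (fun ζ : ℂ => Ycoord p (u ζ)) ξ)))‖
      ≤ ‖fderiv ℝ (ι ∘ (extChartAt (𝓡 4) p).symm)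
          (extChartAt (𝓡 4) p p + inversion (realify (Ycoord p (u ξ))))‖ *
        ‖(fderiv ℝ inversion (realify (Ycoord p (u ξ)))).comp
          (realifyL.comp (fderiv ℝ (fun ζ : ℂ => Ycoord p (u ζ)) ξ))‖ :=
      ContinuousLinearMap.opNorm_comp_le _ _
    _ ≤ M * ((‖realify (Ycoord p (u ξ))‖ ^ 2)⁻¹ *
          (‖realifyL‖ * ‖fderiv ℝ (fun ζ : ℂ => Ycoord p (u ζ)) ξ‖)) := by
      gcongr
      · exact hM _ hballmem
      · exact (ContinuousLinearMap.opNorm_comp_le _ _).trans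
          (mul_le_mul (norm_fderiv_inversion_le hy0) (ContinuousLinearMap.opNorm_comp_le _ _)
            (norm_nonneg _) (by positivity))
    _ = M * ‖realifyL‖ * ‖fderiv ℝ (fun ζ : ℂ => Ycoord p (u ζ)) ξ‖ *
          (‖realify (Ycoord p (u ξ))‖ ^ 2)⁻¹ := by
      ring

/-! ### The registered helper -/

/-- A `C^∞` curve `u : ℂ → Σ ∖ p` read through a smooth `ι : Σ → ℝᴺ` is a `C^∞` map `ℂ → ℝᴺ`. -/
theorem contDiff_comp_val {p : S.carrier} {N : ℕ} {ι : S.carrier → EuclideanSpace ℝ (Fin N)}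
    (hι : ContMDiff (𝓡 4) 𝓘(ℝ, EuclideanSpace ℝ (Fin N)) ∞ ι) {u : ℂ → punctured p}
    (hu : ContMDiff 𝓘(ℝ, ℂ) (𝓡 4) ∞ u) : ContDiff ℝ ∞ (fun ζ : ℂ => ι (u ζ).1) :=
  contMDiff_iff_contDiff.1
    (hι.comp ((contMDiff_subtype_val (I := 𝓡 4) (n := ∞) (U := punctured p)).comp hu))

/-- **Registered helper `helper_lineEnergy_line_lt_top`** (line `crofton-pencil-laminar-charge`,
crux `Target`): for `J` standard on the punctured `ε'`-chart-ball at `p` (closed `ε'`-ball inside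
the chart target), every `J`-LINE `u` of either chart `σ` with any data `(a, b)`
(`IsLine σ J u a b`) has FINITE energy `lineEnergy ι u < ⊤` for every smooth `ι : Σ → ℝᴺ`:
properness puts the curve eventually in the flat end, where `Y ∘ u` is holomorphic and
asymptotically affine, so that `‖d(ι ∘ u)(ξ)‖ = O(‖ξ‖⁻²)` by the removable singularity at
infinity and the chain rule through the inverted chart; the rest of `ℂ` is compact. -/
theorem helper_lineEnergy_line_lt_top :
    ∀ (S : HomotopySphere 4) (p : S.carrier)
      (J : ∀ x : punctured p, TangentSpace (𝓡 4) x →L[ℝ] TangentSpace (𝓡 4) x) (ε' : ℝ),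
      0 < ε' →
      Metric.closedBall (extChartAt (𝓡 4) p p) ε' ⊆ (extChartAt (𝓡 4) p).target →
      (∀ x : punctured p, InPuncturedChartBall p ε' x →
        ∀ (v : TangentSpace (𝓡 4) x) (b : EuclideanSpace ℝ (Fin 4)),
          inner ℝ (fderiv ℝ inversion (extChartAt (𝓡 4) p x.1 - extChartAt (𝓡 4) p p)
            (mfderiv (𝓡 4) 𝓘(ℝ, EuclideanSpace ℝ (Fin 4))
              (fun z : punctured p => extChartAt (𝓡 4) p z.1) x (J x v))) b
          = stdSymplecticForm (fderiv ℝ inversion (extChartAt (𝓡 4) p x.1 - extChartAt (𝓡 4) p p)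
            (mfderiv (𝓡 4) 𝓘(ℝ, EuclideanSpace ℝ (Fin 4))
              (fun z : punctured p => extChartAt (𝓡 4) p z.1) x v)) b) →
      ∀ (N : ℕ) (ι : S.carrier → EuclideanSpace ℝ (Fin N)),
        ContMDiff (𝓡 4) 𝓘(ℝ, EuclideanSpace ℝ (Fin N)) ∞ ι →
        ∀ (σ : Bool) (a b : ℂ) (u : ℂ → punctured p), IsLine σ J u a b → lineEnergy ι u < ⊤ := by
  intro S p J ε' hε' hball hJstd N ι hι σ a b u hline
  obtain ⟨hcurve, -, -, hproper, hlim1, hlim2⟩ := hline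
  have hu : ContMDiff 𝓘(ℝ, ℂ) (𝓡 4) ∞ u := hcurve.contMDiff
  have hhol : IsJHolomorphic (𝓡 4) J u := hcurve.isJHolomorphic
  -- (1) properness: the curve is eventually in the punctured `ε'`-chart-ball
  obtain ⟨r₀, hr₀⟩ := eventually_inBall_of_proper hproper hε'
  -- (2) holomorphy of `Y ∘ u` there (`J` standard on the ball)
  have hYdiff : ∀ ξ : ℂ, r₀ < ‖ξ‖ → DifferentiableAt ℂ (fun ζ : ℂ => Ycoord p (u ζ)) ξ :=
    fun ξ hξ => differentiableAt_Ycoord_comp J hJstd hu hhol (hr₀ ξ hξ)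
  -- (2') decay at infinity: `‖d(Y ∘ u)‖ ≤ D` and `‖ξ‖ ≤ 2 ‖realify (Y (u ξ))‖` for `r₁ ≤ ‖ξ‖`
  obtain ⟨D, r₁, hD0, h1r₁, hr₀₁, hfar⟩ : ∃ D r₁ : ℝ, 0 ≤ D ∧ 1 ≤ r₁ ∧ r₀ ≤ r₁ ∧
      ∀ ξ : ℂ, r₁ ≤ ‖ξ‖ → ‖fderiv ℝ (fun ζ : ℂ => Ycoord p (u ζ)) ξ‖ ≤ D ∧
        ‖ξ‖ ≤ 2 * ‖realify (Ycoord p (u ξ))‖ := by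
    cases σ with
    | false =>
      simp only [Yc, Bool.false_eq_true, ↓reduceIte] at hlim1 hlim2
      obtain ⟨D, r₁, hD0, h1r₁, hr₀₁, h⟩ := fderiv_bound_of_asymptotic
        (fun ξ hξ => (hYdiff ξ hξ).differentiableWithinAt) hlim1 hlim2
      exact ⟨D, r₁, hD0, h1r₁, hr₀₁, fun ξ hξ => ⟨(h ξ hξ).1,
        (h ξ hξ).2.trans (by gcongr; exact norm_fst_le_norm_realify _)⟩⟩
    | true =>
      simp only [Yc, ↓reduceIte] at hlim1 hlim2
      obtain ⟨D, r₁, hD0, h1r₁, hr₀₁, h⟩ := fderiv_bound_of_asymptotic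
        (Y := fun ζ : ℂ => ((Ycoord p (u ζ)).2, (Ycoord p (u ζ)).1))
        (fun ξ hξ => ((hYdiff ξ hξ).snd.prodMk (hYdiff ξ hξ).fst).differentiableWithinAt)
        hlim1 hlim2
      refine ⟨D, r₁, hD0, h1r₁, hr₀₁, fun ξ hξ =>
        ⟨?_, (h ξ hξ).2.trans (by gcongr; exact norm_snd_le_norm_realify _)⟩⟩
      -- `Y ∘ u` is the swap of `ζ ↦ ((Y (u ζ)).2, (Y (u ζ)).1)`, and the swap is an isometry
      have hsw : (fun ζ : ℂ => Ycoord p (u ζ)) = (ContinuousLinearEquiv.prodComm ℝ ℂ ℂ) ∘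
          (fun ζ : ℂ => ((Ycoord p (u ζ)).2, (Ycoord p (u ζ)).1)) := by
        funext ζ
        simp
      rw [hsw, ContinuousLinearEquiv.comp_fderiv]
      refine le_trans (ContinuousLinearMap.opNorm_le_bound _ (norm_nonneg _) fun v => ?_)
        (h ξ hξ).1
      rw [ContinuousLinearMap.comp_apply, ContinuousLinearEquiv.coe_coe,
        ContinuousLinearEquiv.prodComm_apply, Prod.norm_def, Prod.fst_swap, Prod.snd_swap,
        max_comm, ← Prod.norm_def]
      exact ContinuousLinearMap.le_opNorm _ _
  -- (3) the chain rule through the flat chart, far out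
  obtain ⟨M, hM0, hchain⟩ := norm_fderiv_comp_le_of_eventually hε' hball hι u
  have hopen : IsOpen {ξ : ℂ | r₁ < ‖ξ‖} := isOpen_lt continuous_const continuous_norm
  have hfarpt : ∀ ξ : ℂ, r₁ < ‖ξ‖ → ‖fderiv ℝ (fun ζ : ℂ => ι (u ζ).1) ξ‖ ≤
      4 * M * D * ((2 * ‖realify (Ycoord p (u ξ))‖) ^ 2)⁻¹ := by
    intro ξ hξ
    have hev : ∀ᶠ ζ in 𝓝 ξ, InPuncturedChartBall p ε' (u ζ) :=
      eventually_of_mem (hopen.mem_nhds hξ) fun ζ hζ => hr₀ ζ (hr₀₁.trans_lt hζ)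
    have h := hchain ξ hev ((hYdiff ξ (hr₀₁.trans_lt hξ)).restrictScalars ℝ)
    obtain ⟨hDξ, -⟩ := hfar ξ hξ.le
    calc ‖fderiv ℝ (fun ζ : ℂ => ι (u ζ).1) ξ‖
        ≤ M * ‖fderiv ℝ (fun ζ : ℂ => Ycoord p (u ζ)) ξ‖ * (‖realify (Ycoord p (u ξ))‖ ^ 2)⁻¹ := h
      _ ≤ M * D * (‖realify (Ycoord p (u ξ))‖ ^ 2)⁻¹ := by gcongr
      _ = 4 * M * D * ((2 * ‖realify (Ycoord p (u ξ))‖) ^ 2)⁻¹ := by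
        rw [mul_pow, mul_inv]
        ring
  -- (4) the compact part: `ι ∘ u` is `C^∞`, so `‖d(ι ∘ u)‖ ≤ M'` on the closed `r₁`-ball
  obtain ⟨M', hM'⟩ := (isCompact_closedBall (0 : ℂ) r₁).exists_bound_of_continuousOn
    ((contDiff_comp_val hι hu).continuous_fderiv (by simp)).continuousOn
  have hr₁0 : 0 ≤ r₁ := zero_le_one.trans h1r₁
  have hM'0 : 0 ≤ M' := (norm_nonneg _).trans (hM' 0 (Metric.mem_closedBall_self hr₁0))
  -- (5) pointwise domination by `K (1 + ‖ξ‖)⁻⁴`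
  have hm : 0 < min 1 ε'⁻¹ := lt_min one_pos (inv_pos.2 hε')
  have hK₁0 : 0 ≤ 16 * (4 * M * D) ^ 2 / (min 1 ε'⁻¹) ^ 4 := by positivity
  have hK₂0 : 0 ≤ M' ^ 2 * (1 + r₁) ^ 4 := by positivity
  have hpt : ∀ ξ : ℂ, ‖fderiv ℝ (fun ζ : ℂ => ι (u ζ).1) ξ‖ ^ 2 ≤
      (16 * (4 * M * D) ^ 2 / (min 1 ε'⁻¹) ^ 4 + M' ^ 2 * (1 + r₁) ^ 4) *
        (1 + ‖ξ‖) ^ (-(4 : ℝ)) := by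
    intro ξ
    have h1t : 0 < 1 + ‖ξ‖ := by positivity
    have hrpow : 0 ≤ (1 + ‖ξ‖) ^ (-(4 : ℝ)) := by positivity
    rcases le_or_gt ‖ξ‖ r₁ with hle | hlt
    · -- near
      have hb : ‖fderiv ℝ (fun ζ : ℂ => ι (u ζ).1) ξ‖ ≤ M' := hM' ξ (mem_closedBall_zero_iff.2 hle)
      have hnear : ‖fderiv ℝ (fun ζ : ℂ => ι (u ζ).1) ξ‖ ^ 2 ≤
          M' ^ 2 * (1 + r₁) ^ 4 * (1 + ‖ξ‖) ^ (-(4 : ℝ)) := by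
        rw [Real.rpow_neg h1t.le, Real.rpow_ofNat]
        have h14 : 0 < (1 + ‖ξ‖) ^ 4 := by positivity
        calc ‖fderiv ℝ (fun ζ : ℂ => ι (u ζ).1) ξ‖ ^ 2
            ≤ M' ^ 2 := pow_le_pow_left₀ (norm_nonneg _) hb 2
          _ = M' ^ 2 * (1 + ‖ξ‖) ^ 4 * ((1 + ‖ξ‖) ^ 4)⁻¹ := by
            field_simp
          _ ≤ M' ^ 2 * (1 + r₁) ^ 4 * ((1 + ‖ξ‖) ^ 4)⁻¹ := by gcongr
      calc _ ≤ M' ^ 2 * (1 + r₁) ^ 4 * (1 + ‖ξ‖) ^ (-(4 : ℝ)) := hnear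
        _ ≤ _ := by gcongr; linarith
    · -- far
      have hstd : ε'⁻¹ < ‖realify (Ycoord p (u ξ))‖ :=
        Ycoord_mem_stdEnd hε' (hr₀ ξ (hr₀₁.trans_lt hlt))
      have hmr : min 1 ε'⁻¹ ≤ 2 * ‖realify (Ycoord p (u ξ))‖ := by
        have := min_le_right (1 : ℝ) ε'⁻¹
        nlinarith [norm_nonneg (realify (Ycoord p (u ξ)))]
      have hfar' : ‖fderiv ℝ (fun ζ : ℂ => ι (u ζ).1) ξ‖ ^ 2 ≤
          16 * (4 * M * D) ^ 2 / (min 1 ε'⁻¹) ^ 4 * (1 + ‖ξ‖) ^ (-(4 : ℝ)) :=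
        sq_le_decay hm (min_le_left _ _) hmr (hfar ξ hlt.le).2 (norm_nonneg ξ) (norm_nonneg _)
          (hfarpt ξ hlt)
      calc _ ≤ 16 * (4 * M * D) ^ 2 / (min 1 ε'⁻¹) ^ 4 * (1 + ‖ξ‖) ^ (-(4 : ℝ)) := hfar'
        _ ≤ _ := by gcongr; linarith
  -- (6) integrate: `∫ (1 + ‖ξ‖)⁻⁴ < ∞` on `ℂ` (`finrank ℝ ℂ = 2 < 4`)
  unfold lineEnergy
  calc ∫⁻ ξ : ℂ, ENNReal.ofReal (‖fderiv ℝ (fun ζ : ℂ => ι (u ζ).1) ξ‖ ^ 2)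
      ≤ ∫⁻ ξ : ℂ, ENNReal.ofReal
            (16 * (4 * M * D) ^ 2 / (min 1 ε'⁻¹) ^ 4 + M' ^ 2 * (1 + r₁) ^ 4) *
          ENNReal.ofReal ((1 + ‖ξ‖) ^ (-(4 : ℝ))) :=
        lintegral_mono fun ξ => by
          rw [← ENNReal.ofReal_mul (add_nonneg hK₁0 hK₂0)]
          exact ENNReal.ofReal_le_ofReal (hpt ξ)
    _ = ENNReal.ofReal (16 * (4 * M * D) ^ 2 / (min 1 ε'⁻¹) ^ 4 + M' ^ 2 * (1 + r₁) ^ 4) *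
          ∫⁻ ξ : ℂ, ENNReal.ofReal ((1 + ‖ξ‖) ^ (-(4 : ℝ))) :=
        lintegral_const_mul' _ _ ENNReal.ofReal_ne_top
    _ < ⊤ := ENNReal.mul_lt_top ENNReal.ofReal_lt_top
        (finite_integral_one_add_norm (by rw [Complex.finrank_real_complex]; norm_num))

end Summit.SmoothPoincare4.SmoothPoincare4.Theorems.Target.CroftonPencil

end
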